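import Literature.MathematicalPhysics.QuantumFieldTheory.Balaban1983to89.B9Eq325QprimeStarLowerBoundZd

/-!
# `Balaban1983to89.B9Eq324ConjugatedFormZd` — [Balaban1985BackgroundPropagators] (3.24) p. 394 (`Δ′_a = (Δ^η_U + Q′*aQ′)↾Ω₀`) ∕ Thm 3.1 (3.42), (3.46)
# pp. 397–398: THE CONJUGATED AVERAGING PENALTY OF (3.24) AT THE `ℤᵈ` CARRIER — for a positive site weight `ω`, unitary averaged transporters and a tracial
# Hermitian faithful `τ`, `Σ_{j≤m} a_jΣ_{y∈Λ_j} Re τ((Q′_j(ωΦ))(y)* (Q′_j(ω⁻¹Φ))(y)) ≥ Σ_{j≤m} a_jΣ_{y∈Λ_j}|(Q′_jΦ)(y)|²_τ − Σ_{z∈Ω₀} J_s(z)|Φ(z)|²_τ` with the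
# averaging defect `J_s(z) = Σ_{j≤m} 𝟙[yʲ(z) ∈ Λ_j]·a_j(Lᵈ)^{−j}·(ε_j + ε′_j + ε_jε′_j)` from the oscillation of `ω` on the `j`-blocks (`|ω∕ω̂ − 1| ≤ ε_j`,
# `|ω̂∕ω − 1| ≤ ε′_j`) — FIRST order in the oscillation, at the penalty's own scale `a_j(Lᵈ)^{−j}`

statement-level skeleton of published theorems with citation tags; proofs where landed; nothing here is a claim about the
Yang–Mills mass gap

`[Balaban1985BackgroundPropagators]` ("B9", CMP **99** (1985) 389–434): (3.24) p. 394 *«Δ′_a = Δ′_a(U) = (Δ^η_U + Q′*aQ′)↾_{Ω₀} … ⟨λ, Q′*aQ′λ⟩ =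
Σ_{j=0}^{k} a_j Σ_{y∈Λ_j}(Lʲη)^{d−2}|(Q′_j(U)λ)(y)|²»*; (3.19) p. 393; Thm 3.1 p. 397 with (3.42), (3.46) p. 398 (print: random walk of Sects. B–C).  The route's Agmon
reading (`B9Eq346AgmonReadingZd`, this seat g5) reads a CONJUGATED coercivity; this file bounds the conjugation defect of the averaging penalty and assembles it with
the Laplacian half (`B9Eq323ConjugatedLaplacianFormZd`) through dag-n06-w4 g2's polarized identity `formE_deltaPrimeADom`.  On one `j`-block with reference value `ω̂`:
`Q′_j(ωΦ) = ω̂·Q′_jΦ + Q′_j((ω − ω̂)Φ)`, `Q′_j(ω⁻¹Φ) = ω̂⁻¹Q′_jΦ + Q′_j((ω⁻¹ − ω̂⁻¹)Φ)`, and `|(Q′_jg)(y)|_τ ≤ (Lᵈ)^{−j}Σ_{x∈Bʲ(y)}|g(x)|_τ` for unitary averaged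
transporters, so the conjugated product is `≥ |(Q′_jΦ)(y)|²_τ − (ε + ε′ + εε′)(Lᵈ)^{−j}Σ_{x∈Bʲ(y)∩Ω₀}|Φ(x)|²_τ` — first order in the block oscillation, met by level
masses `(Lʲη)⁻²` since `a_j(Lᵈ)^{−j} ≈ a(Lʲη)⁻²` in the unweighted currency.

CITATION HEADER (lean-in-tree rule).  Cell `pub-ymgap` (YM Track A, HUMAN RULING D-0062 ∕ D-0149 width push), DAG node N06 = [B9], width seat
`pub-ymgap-dag-n06-w2` (g5), CLAIM-2 FILE 2b («Agmon ∕ form-relative edition of the Combes–Thomas road at the ℤᵈ frame»).  Inputs BY NAME: `formE_deltaPrimeADom ∕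
deltaPrimeADom ∕ QprimeLin ∕ single ∕ eq_sum_single` (dag-n06-w4 g2), `QprimeIter_single ∕ blockMapIter ∕ trIter ∕ blockMapIter_eq_blockMap_pow` (dag-n06-w4 g2),
`fnorm_trIter` (dag-n06-w4 g5), `mem_blockSites_iff ∕ card_blockSites` (`QuantumLattice`), the engine (this seat g4).  Nothing restated.

WHAT IS PROVED (kernel, 0 sorry, 0 def; no `instance`, no `notation`).
* §1 `re_trace_pair_expand4` (`Re τ((pa + a₁)* (qa + a₂))` expanded, Hermitian `τ`), ★ `QprimeIter_eq_sum_trIter` (`(Q′_jg)(y) = Σ_{x∈Ω₀, yʲ(x)=y} trIter_j x (g x)` for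
  `g` supported in `Ω₀`), ★ `fnorm_QprimeIter_le` (`|(Q′_jg)(y)|_τ ≤ (Lᵈ)^{−j}Σ_{x∈Ω₀, yʲ(x)=y}|g x|_τ`, unitary transporters), `card_filter_blockMapIter_le`
  (`#{x ∈ Ω₀ : yʲ(x) = y} ≤ (Lᵈ)ʲ`), `sq_sum_fnorm_filter_le` (Cauchy–Schwarz on the block: `((Lᵈ)^{−j}Σ|g|)² ≤ (Lᵈ)^{−j}Σ|g|²`).
* §2 ★★ `re_trace_conj_QprimeIter_ge` — ONE BLOCK: `Re τ((Q′_j(ωΦ))(y)* (Q′_j(ω⁻¹Φ))(y)) ≥ Re τ((Q′_jΦ)(y)*(Q′_jΦ)(y)) − (ε + ε′ + εε′)(Lᵈ)^{−j}Σ_{x∈Ω₀, yʲ(x)=y}|Φ x|²_τ`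
  under `|ω(x)∕ω̂ − 1| ≤ ε`, `|ω̂∕ω(x) − 1| ≤ ε′` on the block.
* §3 ★★ `sum_conj_QprimeIter_ge` — ALL LEVELS AND BLOCKS: `Σ_{j≤m} a_jΣ_{y∈Λ_j} Re τ((Q′_j(ωΦ))(y)*(Q′_j(ω⁻¹Φ))(y)) ≥ Σ_{j≤m} a_jΣ_{y∈Λ_j}|(Q′_jΦ)(y)|²_τ −
  Σ_{z∈Ω₀} J_s(z)|Φ(z)|²_τ`, `J_s(z) = Σ_{j≤m} 𝟙[yʲ(z) ∈ Λ_j]·a_j(ε_j + ε′_j + ε_jε′_j)(Lᵈ)^{−j}` (`a_j ≥ 0`).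
(The assembly with the Laplacian half through `formE_deltaPrimeADom` — the conjugated form of the genuine `Ω₀Δ′_a(U₀)Ω₀` — is §1 of the sequel `B9Thm31GpAgmonDecayZd`.)

HONEST SCOPE.  [folklore] block algebra and Cauchy–Schwarz; NO estimate of [B9] is proved — the level-weighted coercivity `c₀Σ_z M_z|Φ z|² ≤ ⟨Φ, Δ′_aΦ⟩` against which the
defect is measured is DISPLAYED in the assembly file `B9Thm31GpAgmonDecayZd` (dag-n06-w4's lane: `B9Thm31FlatPoincareCoerciveZd` at `U₀ = 1`, the curved class to
follow); the identification of an admissible `ω = e^{κρ}` with print's weighted distance over the cube geometry is not made here.  Constants crude (`5∕2`, `ε + ε′ +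
εε′`).  Count-neutral; N05 ∕ N06 NOT discharged; K1⁹ `stmt-QuantumFields-27364` NOT closed; one finite `𝕋⁴` programme at fixed `ε`, Bałaban as printed; R4 closes only
the conditional finite-`𝕋⁴` rung `BalabanLadder.UV` — nothing continuum ∕ ℝ⁴ ∕ OS ∕ mass gap ∕ Clay.  Unit `pub-ymgap-dag-n06-w2` (g5), 2026-08-28.
-/

noncomputable section

open scoped BigOperators

namespace Literature.MathematicalPhysics.QuantumFieldTheory.Balaban1983to89.B9Eq324ConjugatedFormZd

open Literature.MathematicalPhysics.QuantumLattice (blockMap blockSites mem_blockSites_iff card_blockSites)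
open B7Prop1Explicit (e)
open B7Eq78Linearization (conjR QprimeIter zdBlocking)
open B7Prop2Explicit (unitaryUnits)
open B8Ineq132 (covDerivFwd)
open B8Eq119TwistedAxial (bgT)
open B9Eq321LandauProjectionZd (suppSub formE formE_apply)
open B9Eq324DeltaPrimeAZd (fibreForm fibreForm_apply fibreForm_comm single eq_sum_single QprimeLin QprimeLin_apply)
open B9Eq325QprimeSingleSiteZd (blockMapIter trIter QprimeIter_single blockMapIter_eq_blockMap_pow)
open B9Eq325QprimeStarLowerBoundZd (fnorm_trIter)
open B9Eq342CombesThomasFormZd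

export B7Prop1Explicit (Site)

variable {d : ℕ} {𝔸 : Type*} [CStarAlgebra 𝔸] (τ : 𝔸 →ₗ[ℂ] ℂ)

/-! ## §1  `Q′_j` on a field supported in `Ω₀`: the transport sum, its size, the block count -/

section Block

variable {L : ℕ} {U₀ : Site d → Fin d → 𝔸ˣ} {s : Finset (Site d)}

/-- `Re τ((c•a)* b) = c·Re τ(a* b)`, real `c`. [folklore] [cite: Balaban1985BackgroundPropagators, p.391 (bookkeeping)] -/
private theorem re_smul_left (c : ℝ) (a b : 𝔸) : (τ (star (c • a) * b)).re = c * (τ (star a * b)).re := by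
  rw [star_smul, star_trivial, smul_mul_assoc, ← Complex.coe_smul, map_smul, smul_eq_mul, Complex.re_ofReal_mul]

/-- `Re τ(a* (c•b)) = c·Re τ(a* b)`, real `c`. [folklore] [cite: Balaban1985BackgroundPropagators, p.391 (bookkeeping)] -/
private theorem re_smul_right (c : ℝ) (a b : 𝔸) : (τ (star a * (c • b))).re = c * (τ (star a * b)).re := by
  rw [mul_smul_comm, ← Complex.coe_smul, map_smul, smul_eq_mul, Complex.re_ofReal_mul]

/-- **FOUR-TERM EXPANSION** (Hermitian `τ`): `Re τ((p•a + a₁)* (q•a + a₂)) = pq·Re τ(a*a) + p·Re τ(a*a₂) + q·Re τ(a*a₁) + Re τ(a₁*a₂)`.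
[folklore] [cite: Balaban1985BackgroundPropagators, (3.24) p.394 (bookkeeping for the conjugated penalty)] -/
theorem re_trace_pair_expand4 (hτs : ∀ a : 𝔸, τ (star a) = starRingEnd ℂ (τ a)) (a a₁ a₂ : 𝔸) (p q : ℝ) :
    (τ (star (p • a + a₁) * (q • a + a₂))).re =
      p * q * (τ (star a * a)).re + p * (τ (star a * a₂)).re + q * (τ (star a * a₁)).re + (τ (star a₁ * a₂)).re := by
  have hsymm : (τ (star a₁ * a)).re = (τ (star a * a₁)).re := by
    rw [← fibreForm_apply, fibreForm_comm τ hτs, fibreForm_apply]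
  simp only [star_add, add_mul, mul_add, map_add, Complex.add_re, re_smul_left, re_smul_right, hsymm]
  ring

omit τ in
/-- ★ **`Q′_j` ON A FIELD SUPPORTED IN `Ω₀`**: `(Q′_j(U₀)g)(y) = Σ_{x∈Ω₀, yʲ(x) = y} trIter_j x (g x)` (`yʲ(x) = blockMap^[j] x`; linearity over the single-site
decomposition and dag-n06-w4 g2's `QprimeIter_single`). [cite: Balaban1985BackgroundPropagators, (3.18)–(3.19) p.393] -/
theorem QprimeIter_eq_sum_trIter [NeZero L] (j : ℕ) {g : Site d → 𝔸} (hg : ∀ z, z ∉ s → g z = 0) (y : Site d) :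
    QprimeIter (zdBlocking d L) (bgT L U₀) j g y = ∑ x ∈ s.filter (fun x => blockMapIter L j x = y), trIter L U₀ j x (g x) := by
  classical
  have hS : ∀ k, g k ≠ 0 → k ∈ s := fun k hk => by
    by_contra h
    exact hk (hg k h)
  have hg' : g = ∑ x ∈ s, single x (g x) := eq_sum_single hS
  have h2 : QprimeLin L U₀ j g = ∑ x ∈ s, QprimeLin L U₀ j (single x (g x)) := by
    rw [← map_sum]
    exact congrArg _ hg'
  have h3 := congrFun h2 y
  rw [QprimeLin_apply, Finset.sum_apply] at h3
  rw [h3, Finset.sum_filter]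
  refine Finset.sum_congr rfl fun x _ => ?_
  rw [QprimeLin_apply, QprimeIter_single L U₀ x (g x) j y]

/-- ★ **THE SIZE OF `Q′_j` ON A FIELD SUPPORTED IN `Ω₀`**: `|(Q′_jg)(y)|_τ ≤ (Lᵈ)^{−j}·Σ_{x∈Ω₀, yʲ(x)=y}|g(x)|_τ` when the averaged transporters below level `j`
are unitary (`|trIter_j x X|_τ = (Lᵈ)^{−j}|X|_τ`, dag-n06-w4 g5). [cite: Balaban1985BackgroundPropagators, (3.18)–(3.19) p.393; Balaban1985Averaging, Prop. 2 p.26] -/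
theorem fnorm_QprimeIter_le [NeZero L] (hτp : ∀ a : 𝔸, a ≠ 0 → 0 < (τ (star a * a)).re) (hτt : ∀ a b : 𝔸, τ (a * b) = τ (b * a))
    (hτs : ∀ a : 𝔸, τ (star a) = starRingEnd ℂ (τ a)) {j : ℕ} (hT : ∀ j', j' < j → ∀ z y : Site d, bgT L U₀ j' z y ∈ unitaryUnits 𝔸)
    {g : Site d → 𝔸} (hg : ∀ z, z ∉ s → g z = 0) (y : Site d) :
    fnorm τ (QprimeIter (zdBlocking d L) (bgT L U₀) j g y) ≤
      (((L : ℝ) ^ d)⁻¹) ^ j * ∑ x ∈ s.filter (fun x => blockMapIter L j x = y), fnorm τ (g x) := by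
  rw [QprimeIter_eq_sum_trIter j hg y, Finset.mul_sum]
  refine (fnorm_sum_le hτp hτs _ _).trans (Finset.sum_le_sum fun x _ => ?_)
  rw [fnorm_trIter τ hτt x (g x) j hT]

omit [CStarAlgebra 𝔸] in
/-- **THE BLOCK COUNT**: `#{x ∈ Ω₀ : yʲ(x) = y} ≤ (Lᵈ)ʲ` — the fibre of `blockMap^[j] = blockMap (Lʲ)` over `y` is the block `blockSites (Lʲ) y` of `(Lʲ)ᵈ` sites.
[cite: Balaban1985Averaging, (78) p.30 («B(y) … Lᵈ sites»)] -/
theorem card_filter_blockMapIter_le [NeZero L] (j : ℕ) (y : Site d) :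
    ((s.filter (fun x => blockMapIter L j x = y)).card : ℝ) ≤ ((L : ℝ) ^ d) ^ j := by
  classical
  haveI : NeZero (L ^ j) := ⟨pow_ne_zero j (NeZero.ne L)⟩
  have hsub : s.filter (fun x => blockMapIter L j x = y) ⊆ blockSites (L ^ j) y := by
    intro x hx
    rw [Finset.mem_filter] at hx
    rw [mem_blockSites_iff, ← blockMapIter_eq_blockMap_pow]
    exact hx.2
  have hcard := Finset.card_le_card hsub
  rw [card_blockSites] at hcard
  have h : ((s.filter (fun x => blockMapIter L j x = y)).card : ℝ) ≤ ((L ^ j) ^ d : ℕ) := by exact_mod_cast hcard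
  refine h.trans_eq ?_
  push_cast
  rw [← pow_mul, ← pow_mul, mul_comm]

/-- **CAUCHY–SCHWARZ ON THE BLOCK**: `((Lᵈ)^{−j}Σ_{x∈Ω₀, yʲ(x)=y}|g x|_τ)² ≤ (Lᵈ)^{−j}·Σ_{x∈Ω₀, yʲ(x)=y}|g x|²_τ` (`L ≥ 1`).
[folklore] [cite: Balaban1985BackgroundPropagators, (3.19) p.393 (bookkeeping)] -/
theorem sq_sum_fnorm_filter_le [NeZero L] (j : ℕ) (y : Site d) (g : Site d → 𝔸) :
    ((((L : ℝ) ^ d)⁻¹) ^ j * ∑ x ∈ s.filter (fun x => blockMapIter L j x = y), fnorm τ (g x)) ^ 2 ≤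
      (((L : ℝ) ^ d)⁻¹) ^ j * ∑ x ∈ s.filter (fun x => blockMapIter L j x = y), fnorm τ (g x) ^ 2 := by
  set F := s.filter (fun x => blockMapIter L j x = y) with hF
  have hL : (0 : ℝ) < (L : ℝ) ^ d := by
    have : (0 : ℝ) < L := by exact_mod_cast Nat.pos_of_ne_zero (NeZero.ne L)
    positivity
  set w : ℝ := (((L : ℝ) ^ d)⁻¹) ^ j with hw
  have hw0 : 0 < w := by positivity
  have hwcard : w * (F.card : ℝ) ≤ 1 := by
    have hc := card_filter_blockMapIter_le (s := s) (L := L) j y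
    rw [hw, inv_pow]
    rw [inv_mul_le_iff₀ (pow_pos hL j), mul_one]
    exact hc
  have hCS := sq_sum_le_card_mul_sum_sq (s := F) (f := fun x => fnorm τ (g x))
  have hS2 : 0 ≤ ∑ x ∈ F, fnorm τ (g x) ^ 2 := Finset.sum_nonneg fun x _ => sq_nonneg _
  calc (w * ∑ x ∈ F, fnorm τ (g x)) ^ 2 = w * (w * (∑ x ∈ F, fnorm τ (g x)) ^ 2) := by ring
    _ ≤ w * (w * ((F.card : ℝ) * ∑ x ∈ F, fnorm τ (g x) ^ 2)) := by gcongr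
    _ = w * ((w * (F.card : ℝ)) * ∑ x ∈ F, fnorm τ (g x) ^ 2) := by ring
    _ ≤ w * (1 * ∑ x ∈ F, fnorm τ (g x) ^ 2) := by gcongr
    _ = w * ∑ x ∈ F, fnorm τ (g x) ^ 2 := by rw [one_mul]

end Block

/-! ## §2  One block: the conjugated product of `Q′_j` -/

section OneBlock

variable {L : ℕ} {U₀ : Site d → Fin d → 𝔸ˣ} {s : Finset (Site d)}

/-- ★★ **ONE BLOCK.**  `L ≥ 1`, unitary averaged transporters below level `j`, tracial Hermitian faithful `τ`, `ω > 0`, a reference value `ω̂ > 0` with block oscillations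
`|ω(x)∕ω̂ − 1| ≤ ε`, `|ω̂∕ω(x) − 1| ≤ ε′` for `x ∈ Ω₀` with `yʲ(x) = y` (`ε, ε′ ≥ 0`), `Φ ∈ L²(Ω₀, ·)`.  THEN
`Re τ((Q′_jΦ)(y)* (Q′_jΦ)(y)) − (ε + ε′ + εε′)·(Lᵈ)^{−j}·Σ_{x∈Ω₀, yʲ(x)=y}|Φ(x)|²_τ ≤ Re τ((Q′_j(ωΦ))(y)* (Q′_j(ω⁻¹Φ))(y))`.
[cite: Balaban1985BackgroundPropagators, (3.24) p.394, (3.19) p.393, Thm 3.1 (3.46) p.398; Agmon1982, Thm 1.5 p.19] -/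
theorem re_trace_conj_QprimeIter_ge [NeZero L] (hτp : ∀ a : 𝔸, a ≠ 0 → 0 < (τ (star a * a)).re) (hτt : ∀ a b : 𝔸, τ (a * b) = τ (b * a))
    (hτs : ∀ a : 𝔸, τ (star a) = starRingEnd ℂ (τ a)) {j : ℕ} (hT : ∀ j', j' < j → ∀ z y : Site d, bgT L U₀ j' z y ∈ unitaryUnits 𝔸)
    {ω : Site d → ℝ} (hω : ∀ z, 0 < ω z) {wr ε ε' : ℝ} (hwr : 0 < wr) (hε : 0 ≤ ε) (hε' : 0 ≤ ε') (y : Site d)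
    (hosc : ∀ x ∈ s, blockMapIter L j x = y → |ω x / wr - 1| ≤ ε ∧ |wr / ω x - 1| ≤ ε') (Φ : suppSub (𝔸 := 𝔸) s) :
    (τ (star (QprimeIter (zdBlocking d L) (bgT L U₀) j (Φ : Site d → 𝔸) y) * QprimeIter (zdBlocking d L) (bgT L U₀) j (Φ : Site d → 𝔸) y)).re -
        (ε + ε' + ε * ε') * ((((L : ℝ) ^ d)⁻¹) ^ j * ∑ x ∈ s.filter (fun x => blockMapIter L j x = y), fnorm τ ((Φ : Site d → 𝔸) x) ^ 2) ≤
      (τ (star (QprimeIter (zdBlocking d L) (bgT L U₀) j (fun z => ω z • (Φ : Site d → 𝔸) z) y) *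
        QprimeIter (zdBlocking d L) (bgT L U₀) j (fun z => (ω z)⁻¹ • (Φ : Site d → 𝔸) z) y)).re := by
  classical
  set F : Site d → 𝔸 := (Φ : Site d → 𝔸) with hF
  have hFs : ∀ z, z ∉ s → F z = 0 := fun z hz => Φ.2 z hz
  set Fset := s.filter (fun x => blockMapIter L j x = y) with hFset
  set w : ℝ := (((L : ℝ) ^ d)⁻¹) ^ j with hw
  -- the decomposition `ωΦ = ω̂Φ + (ω − ω̂)Φ`, `ω⁻¹Φ = ω̂⁻¹Φ + (ω⁻¹ − ω̂⁻¹)Φ`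
  set g₁ : Site d → 𝔸 := fun z => (ω z - wr) • F z with hg₁
  set g₂ : Site d → 𝔸 := fun z => ((ω z)⁻¹ - wr⁻¹) • F z with hg₂
  have hg₁s : ∀ z, z ∉ s → g₁ z = 0 := fun z hz => by simp only [hg₁, hFs z hz, smul_zero]
  have hg₂s : ∀ z, z ∉ s → g₂ z = 0 := fun z hz => by simp only [hg₂, hFs z hz, smul_zero]
  set a : 𝔸 := QprimeIter (zdBlocking d L) (bgT L U₀) j F y with ha
  set a₁ : 𝔸 := QprimeIter (zdBlocking d L) (bgT L U₀) j g₁ y with ha₁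
  set a₂ : 𝔸 := QprimeIter (zdBlocking d L) (bgT L U₀) j g₂ y with ha₂
  have hplus : QprimeIter (zdBlocking d L) (bgT L U₀) j (fun z => ω z • F z) y = wr • a + a₁ := by
    have hfun : (fun z => ω z • F z) = wr • F + g₁ := by
      funext z; simp only [hg₁, Pi.add_apply, Pi.smul_apply, sub_smul]; abel
    have h := congrFun (show QprimeLin L U₀ j (fun z => ω z • F z) = wr • QprimeLin L U₀ j F + QprimeLin L U₀ j g₁ by
      rw [hfun, map_add, map_smul]) y
    simpa only [QprimeLin_apply, Pi.add_apply, Pi.smul_apply] using h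
  have hminus : QprimeIter (zdBlocking d L) (bgT L U₀) j (fun z => (ω z)⁻¹ • F z) y = wr⁻¹ • a + a₂ := by
    have hfun : (fun z => (ω z)⁻¹ • F z) = wr⁻¹ • F + g₂ := by
      funext z; simp only [hg₂, Pi.add_apply, Pi.smul_apply, sub_smul]; abel
    have h := congrFun (show QprimeLin L U₀ j (fun z => (ω z)⁻¹ • F z) = wr⁻¹ • QprimeLin L U₀ j F + QprimeLin L U₀ j g₂ by
      rw [hfun, map_add, map_smul]) y
    simpa only [QprimeLin_apply, Pi.add_apply, Pi.smul_apply] using h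
  rw [hplus, hminus, re_trace_pair_expand4 τ hτs a a₁ a₂ wr wr⁻¹, mul_inv_cancel₀ hwr.ne', one_mul]
  -- the three sizes
  set S : ℝ := ∑ x ∈ Fset, fnorm τ (F x) with hS
  have hS0 : 0 ≤ S := Finset.sum_nonneg fun x _ => fnorm_nonneg τ _
  have hw0 : 0 ≤ w := by positivity
  have ha_le : fnorm τ a ≤ w * S := fnorm_QprimeIter_le τ hτp hτt hτs hT hFs y
  have ha₁_le : fnorm τ a₁ ≤ wr * ε * (w * S) := by
    refine (fnorm_QprimeIter_le τ hτp hτt hτs hT hg₁s y).trans ?_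
    rw [← hFset, ← hw, show wr * ε * (w * S) = w * (wr * ε * S) by ring, hS, Finset.mul_sum, Finset.mul_sum, Finset.mul_sum]
    refine Finset.sum_le_sum fun x hx => ?_
    rw [Finset.mem_filter] at hx
    rw [hg₁]
    simp only [fnorm_smul]
    refine mul_le_mul_of_nonneg_left (mul_le_mul_of_nonneg_right ?_ (fnorm_nonneg τ _)) hw0
    have h1 := (hosc x hx.1 hx.2).1
    have hrew : ω x - wr = wr * (ω x / wr - 1) := by field_simp
    rw [hrew, abs_mul, abs_of_pos hwr]
    exact mul_le_mul_of_nonneg_left h1 hwr.le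
  have ha₂_le : fnorm τ a₂ ≤ wr⁻¹ * ε' * (w * S) := by
    refine (fnorm_QprimeIter_le τ hτp hτt hτs hT hg₂s y).trans ?_
    rw [← hFset, ← hw, show wr⁻¹ * ε' * (w * S) = w * (wr⁻¹ * ε' * S) by ring, hS, Finset.mul_sum, Finset.mul_sum, Finset.mul_sum]
    refine Finset.sum_le_sum fun x hx => ?_
    rw [Finset.mem_filter] at hx
    rw [hg₂]
    simp only [fnorm_smul]
    refine mul_le_mul_of_nonneg_left (mul_le_mul_of_nonneg_right ?_ (fnorm_nonneg τ _)) hw0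
    have h2 := (hosc x hx.1 hx.2).2
    have hωx := hω x
    have hrew : (ω x)⁻¹ - wr⁻¹ = wr⁻¹ * (wr / ω x - 1) := by field_simp
    rw [hrew, abs_mul, abs_of_pos (inv_pos.2 hwr)]
    exact mul_le_mul_of_nonneg_left h2 (inv_pos.2 hwr).le
  -- Cauchy–Schwarz in the fibre for the three cross terms
  have hc₂ : |(τ (star a * a₂)).re| ≤ fnorm τ a * fnorm τ a₂ := abs_fibreForm_le hτp hτs a a₂
  have hc₁ : |(τ (star a * a₁)).re| ≤ fnorm τ a * fnorm τ a₁ := abs_fibreForm_le hτp hτs a a₁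
  have hc₁₂ : |(τ (star a₁ * a₂)).re| ≤ fnorm τ a₁ * fnorm τ a₂ := abs_fibreForm_le hτp hτs a₁ a₂
  -- `(wS)² ≤ w Σ|Φ|²`
  have hCS : (w * S) ^ 2 ≤ w * ∑ x ∈ Fset, fnorm τ (F x) ^ 2 := sq_sum_fnorm_filter_le τ (s := s) (L := L) j y F
  have ha0 := fnorm_nonneg τ a
  have ha₁0 := fnorm_nonneg τ a₁
  have ha₂0 := fnorm_nonneg τ a₂
  have hwS0 : 0 ≤ w * S := mul_nonneg hw0 hS0
  -- products of the size bounds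
  have hp₂ : wr * (fnorm τ a * fnorm τ a₂) ≤ ε' * (w * S) ^ 2 := by
    have := mul_le_mul ha_le ha₂_le ha₂0 hwS0
    calc wr * (fnorm τ a * fnorm τ a₂) ≤ wr * (w * S * (wr⁻¹ * ε' * (w * S))) := mul_le_mul_of_nonneg_left this hwr.le
      _ = ε' * (w * S) ^ 2 := by
          rw [show wr * (w * S * (wr⁻¹ * ε' * (w * S))) = (wr * wr⁻¹) * (ε' * (w * S) ^ 2) by ring, mul_inv_cancel₀ hwr.ne', one_mul]
  have hp₁ : wr⁻¹ * (fnorm τ a * fnorm τ a₁) ≤ ε * (w * S) ^ 2 := by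
    have := mul_le_mul ha_le ha₁_le ha₁0 hwS0
    calc wr⁻¹ * (fnorm τ a * fnorm τ a₁) ≤ wr⁻¹ * (w * S * (wr * ε * (w * S))) := mul_le_mul_of_nonneg_left this (inv_pos.2 hwr).le
      _ = ε * (w * S) ^ 2 := by
          rw [show wr⁻¹ * (w * S * (wr * ε * (w * S))) = (wr⁻¹ * wr) * (ε * (w * S) ^ 2) by ring, inv_mul_cancel₀ hwr.ne', one_mul]
  have hp₁₂ : fnorm τ a₁ * fnorm τ a₂ ≤ ε * ε' * (w * S) ^ 2 := by
    have := mul_le_mul ha₁_le ha₂_le ha₂0 (by positivity)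
    calc fnorm τ a₁ * fnorm τ a₂ ≤ wr * ε * (w * S) * (wr⁻¹ * ε' * (w * S)) := this
      _ = ε * ε' * (w * S) ^ 2 := by
          rw [show wr * ε * (w * S) * (wr⁻¹ * ε' * (w * S)) = (wr * wr⁻¹) * (ε * ε' * (w * S) ^ 2) by ring, mul_inv_cancel₀ hwr.ne', one_mul]
  -- assemble
  have hsq := Finset.sum_nonneg (s := Fset) fun x (_ : x ∈ Fset) => sq_nonneg (fnorm τ (F x))
  have e1 := neg_abs_le ((τ (star a * a₂)).re)
  have e2 := neg_abs_le ((τ (star a * a₁)).re)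
  have e3 := neg_abs_le ((τ (star a₁ * a₂)).re)
  have hwrpos := hwr
  have hwrinv : 0 < wr⁻¹ := inv_pos.2 hwr
  nlinarith [mul_le_mul_of_nonneg_left hc₂ hwr.le, mul_le_mul_of_nonneg_left hc₁ hwrinv.le, hc₁₂, hp₂, hp₁, hp₁₂, hCS,
    mul_le_mul_of_nonneg_left hCS hε, mul_le_mul_of_nonneg_left hCS hε', mul_le_mul_of_nonneg_left hCS (mul_nonneg hε hε')]

end OneBlock

/-! ## §3  All levels and blocks: the averaging defect `J_s` -/

section Levels

variable {L : ℕ} {U₀ : Site d → Fin d → 𝔸ˣ} {s : Finset (Site d)}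

/-- ★★ **ALL LEVELS AND BLOCKS.**  `L ≥ 1`, averaged transporters unitary below level `m`, tracial Hermitian faithful `τ`, level weights `a_j ≥ 0`, `ω > 0`, per-level
reference values `ω̂_j(y) > 0` and oscillation bounds `ε_j, ε′_j ≥ 0` with `|ω(x)∕ω̂_j(y) − 1| ≤ ε_j`, `|ω̂_j(y)∕ω(x) − 1| ≤ ε′_j` whenever `y ∈ Λ_j`, `x ∈ Ω₀`,
`yʲ(x) = y`.  THEN for `Φ ∈ L²(Ω₀, ·)`:
`Σ_{j≤m} a_jΣ_{y∈Λ_j} Re τ((Q′_jΦ)(y)*(Q′_jΦ)(y)) − Σ_{z∈Ω₀} J_s(z)|Φ(z)|²_τ ≤ Σ_{j≤m} a_jΣ_{y∈Λ_j} Re τ((Q′_j(ωΦ))(y)*(Q′_j(ω⁻¹Φ))(y))`,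
`J_s(z) = Σ_{j≤m} 𝟙[yʲ(z) ∈ Λ_j]·a_j(ε_j + ε′_j + ε_jε′_j)(Lᵈ)^{−j}`.
[cite: Balaban1985BackgroundPropagators, (3.24) p.394, Thm 3.1 (3.46) p.398; Agmon1982, Thm 1.5 p.19] -/
theorem sum_conj_QprimeIter_ge [NeZero L] (hτp : ∀ a : 𝔸, a ≠ 0 → 0 < (τ (star a * a)).re) (hτt : ∀ a b : 𝔸, τ (a * b) = τ (b * a))
    (hτs : ∀ a : 𝔸, τ (star a) = starRingEnd ℂ (τ a)) {m : ℕ} (hT : ∀ j', j' < m → ∀ z y : Site d, bgT L U₀ j' z y ∈ unitaryUnits 𝔸)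
    {a : ℕ → ℝ} (ha : ∀ j, 0 ≤ a j) (Λ : ℕ → Finset (Site d))
    {ω : Site d → ℝ} (hω : ∀ z, 0 < ω z) {wref : ℕ → Site d → ℝ} (hwref : ∀ j y, 0 < wref j y) {ε ε' : ℕ → ℝ} (hε : ∀ j, 0 ≤ ε j) (hε' : ∀ j, 0 ≤ ε' j)
    (hosc : ∀ j ∈ Finset.range (m + 1), ∀ y ∈ Λ j, ∀ x ∈ s, blockMapIter L j x = y →
      |ω x / wref j y - 1| ≤ ε j ∧ |wref j y / ω x - 1| ≤ ε' j)
    (Φ : suppSub (𝔸 := 𝔸) s) :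
    (∑ j ∈ Finset.range (m + 1), a j * ∑ y ∈ Λ j,
        (τ (star (QprimeIter (zdBlocking d L) (bgT L U₀) j (Φ : Site d → 𝔸) y) * QprimeIter (zdBlocking d L) (bgT L U₀) j (Φ : Site d → 𝔸) y)).re) -
        ∑ z ∈ s, (∑ j ∈ Finset.range (m + 1),
          (if blockMapIter L j z ∈ Λ j then a j * (ε j + ε' j + ε j * ε' j) * (((L : ℝ) ^ d)⁻¹) ^ j else 0)) * fnorm τ ((Φ : Site d → 𝔸) z) ^ 2 ≤
      ∑ j ∈ Finset.range (m + 1), a j * ∑ y ∈ Λ j,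
        (τ (star (QprimeIter (zdBlocking d L) (bgT L U₀) j (fun z => ω z • (Φ : Site d → 𝔸) z) y) *
          QprimeIter (zdBlocking d L) (bgT L U₀) j (fun z => (ω z)⁻¹ • (Φ : Site d → 𝔸) z) y)).re := by
  classical
  set F : Site d → 𝔸 := (Φ : Site d → 𝔸) with hF
  -- reorganise the defect per level: `Σ_z J_s(z)|Φ z|² = Σ_j a_j δ_j w^j Σ_{y∈Λ_j} Σ_{x∈Ω₀, yʲ(x)=y} |Φ x|²`
  have hdefect : ∑ z ∈ s, (∑ j ∈ Finset.range (m + 1),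
      (if blockMapIter L j z ∈ Λ j then a j * (ε j + ε' j + ε j * ε' j) * (((L : ℝ) ^ d)⁻¹) ^ j else 0)) * fnorm τ (F z) ^ 2 =
      ∑ j ∈ Finset.range (m + 1), a j * ∑ y ∈ Λ j,
        (ε j + ε' j + ε j * ε' j) * ((((L : ℝ) ^ d)⁻¹) ^ j * ∑ x ∈ s.filter (fun x => blockMapIter L j x = y), fnorm τ (F x) ^ 2) := by
    have hswap : ∑ z ∈ s, (∑ j ∈ Finset.range (m + 1),
        (if blockMapIter L j z ∈ Λ j then a j * (ε j + ε' j + ε j * ε' j) * (((L : ℝ) ^ d)⁻¹) ^ j else 0)) * fnorm τ (F z) ^ 2 =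
        ∑ j ∈ Finset.range (m + 1), ∑ z ∈ s,
          (if blockMapIter L j z ∈ Λ j then a j * (ε j + ε' j + ε j * ε' j) * (((L : ℝ) ^ d)⁻¹) ^ j else 0) * fnorm τ (F z) ^ 2 := by
      rw [Finset.sum_comm]
      exact Finset.sum_congr rfl fun z _ => Finset.sum_mul _ _ _
    rw [hswap]
    refine Finset.sum_congr rfl fun j _ => ?_
    -- the fibrewise sum over the blocks meeting `Λ_j`
    have hfib : ∑ y ∈ Λ j, ∑ x ∈ s.filter (fun x => blockMapIter L j x = y), fnorm τ (F x) ^ 2 =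
        ∑ z ∈ s, (if blockMapIter L j z ∈ Λ j then fnorm τ (F z) ^ 2 else 0) := by
      rw [← Finset.sum_filter]
      simp_rw [Finset.sum_filter]
      rw [Finset.sum_comm]
      exact Finset.sum_congr rfl fun z _ => Finset.sum_ite_eq _ _ _
    rw [Finset.mul_sum]
    have hre : ∑ y ∈ Λ j, a j * ((ε j + ε' j + ε j * ε' j) * ((((L : ℝ) ^ d)⁻¹) ^ j *
        ∑ x ∈ s.filter (fun x => blockMapIter L j x = y), fnorm τ (F x) ^ 2)) =
        a j * (ε j + ε' j + ε j * ε' j) * (((L : ℝ) ^ d)⁻¹) ^ j *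
          ∑ y ∈ Λ j, ∑ x ∈ s.filter (fun x => blockMapIter L j x = y), fnorm τ (F x) ^ 2 := by
      rw [Finset.mul_sum]
      exact Finset.sum_congr rfl fun y _ => by ring
    rw [hre, hfib, Finset.mul_sum]
    refine Finset.sum_congr rfl fun z _ => ?_
    by_cases hz : blockMapIter L j z ∈ Λ j
    · simp only [hz, if_true]
    · simp only [hz, if_false, zero_mul, mul_zero]
  rw [hdefect, ← Finset.sum_sub_distrib]
  refine Finset.sum_le_sum fun j hj => ?_
  rw [Finset.mul_sum, Finset.mul_sum, Finset.mul_sum, ← Finset.sum_sub_distrib]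
  refine Finset.sum_le_sum fun y hy => ?_
  rw [← mul_sub]
  refine mul_le_mul_of_nonneg_left ?_ (ha j)
  have hjm : j < m + 1 := Finset.mem_range.1 hj
  have hTj : ∀ j', j' < j → ∀ z y : Site d, bgT L U₀ j' z y ∈ unitaryUnits 𝔸 := fun j' hj' => hT j' (by omega)
  exact re_trace_conj_QprimeIter_ge τ hτp hτt hτs hTj hω (hwref j y) (hε j) (hε' j) y (fun x hx hxy => hosc j hj y hy x hx hxy) Φ

end Levels


end Literature.MathematicalPhysics.QuantumFieldTheory.Balaban1983to89.B9Eq324ConjugatedFormZd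

end
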